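import Summits.ResolutionOfSingularities.ResolutionOfSingularities.Theorems.PurelyInseparableDim4Rules
import Literature.AlgebraicGeometry.Resolution.CentreBlowupOrdAlongBasics
import Literature.AlgebraicGeometry.Resolution.PointBlowupKangaroo
import HarnessLib

/-!
# TRAP-1 (res-dim4-idea-3): a one-state trap ⇒ `¬ TerminatesSomeRule 2 2` as typed

[OURS · counted 0] **Negative result about OUR candidate frame v2** (`PIDim4.TerminatesSomeRule`: SOME
Hironaka-permissible COORDINATE-centre rule of the presented chart has no infinite branch; desk WORD #17
(iii) of cell `res-dim4-pi`) — nothing about resolution of singularities: the trap is the blindness of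
coordinate centres to a smooth non-coordinate equimultiple curve, and the same trap already lives in
three variables (desk WORD #20 (b): inside Cossart–Piltant's resolved dimension). Found and checked by
res-dim4-idea-3 (TRAP-1), K-checked by res-dim4-crit-2 (lane C) and the desk lane (WORD #20 (a), K-S2-1
of the res-dim4-pi census); filed by res-dim4-typ-1 (brick TY-7). Supports
stmt-ResolutionOfSingularities-16155 (helper). bears_on: LADDER-RESOLUTION:D157-DOOR2 (res-dim4-pi).


`F₀ = x₃x₄ + x₂x₃ + x₂x₃x₄ + x₁²x₂` over `𝔽₂` (`= uv + yu + yuv + x²y`), `s₀ = (F₀, r = 0, exc = {x₂})`.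
(1) `ord F₀ = 2`; (2) the point `univ` is the ONLY Hironaka-permissible coordinate centre; (3) at the point
`b = (0,0,0,1)` of the `x₂`-chart of the point blow-up the step returns `s₀` literally.  Hence `{s₀}` is an
`IsTrap`, so `TerminatesSomeRule 2 2` and `TerminatesSomeRuleQuestion` are false AS TYPED (coordinate
centres of the presented chart).  Geometry: `F₀ = x₃·(x₄ + x₂ + x₂x₄) + x₁²x₂`; the 2-fold locus contains the
smooth curve `{x₁ = x₃ = 0, x₄ = x₂/(1+x₂)}`, equimultiple, non-coordinate, self-similar under the point
blow-up — a statement about the coordinate-centre frame, NOT about resolution of singularities.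
Variables `x₁..x₄` are `Fin 4 = 0..3`.  OURS · CANDIDATE; nothing here proves resolution in dim ≥ 4 / char p; counted 0.
-/

set_option linter.dupNamespace false -- mandated namespace of this single-conjunct summit


namespace Summit.ResolutionOfSingularities.ResolutionOfSingularities.Theorems.PIDim4

noncomputable section

namespace Trap1

open MvPolynomial Finset
open Literature.AlgebraicGeometry.Resolution
open Literature.AlgebraicGeometry.Resolution.Hauser2010
open Literature.AlgebraicGeometry.Resolution.CentreBlowup

/-- The field `𝔽₂`. [folklore] -/
abbrev K2 : Type := ZMod 2

/-- exponent of `x₃x₄` (`uv`). [folklore] -/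
def eUV : Fin 4 →₀ ℕ := Finsupp.equivFunOnFinite.symm ![0, 0, 1, 1]
/-- exponent of `x₂x₃` (`yu`). [folklore] -/
def eYU : Fin 4 →₀ ℕ := Finsupp.equivFunOnFinite.symm ![0, 1, 1, 0]
/-- exponent of `x₂x₃x₄` (`yuv`). [folklore] -/
def eYUV : Fin 4 →₀ ℕ := Finsupp.equivFunOnFinite.symm ![0, 1, 1, 1]
/-- exponent of `x₁²x₂` (`x²y`). [folklore] -/
def eXXY : Fin 4 →₀ ℕ := Finsupp.equivFunOnFinite.symm ![2, 1, 0, 0]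
/-- exponent of `x₃` (`u`), appearing in the chart transform. [folklore] -/
def eU : Fin 4 →₀ ℕ := Finsupp.equivFunOnFinite.symm ![0, 0, 1, 0]

/-- Pointwise values of `eUV`. -/
@[simp] theorem eUV_apply (i : Fin 4) : eUV i = ![0, 0, 1, 1] i := rfl
/-- Pointwise values of `eYU`. -/
@[simp] theorem eYU_apply (i : Fin 4) : eYU i = ![0, 1, 1, 0] i := rfl
/-- Pointwise values of `eYUV`. -/
@[simp] theorem eYUV_apply (i : Fin 4) : eYUV i = ![0, 1, 1, 1] i := rfl
/-- Pointwise values of `eXXY`. -/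
@[simp] theorem eXXY_apply (i : Fin 4) : eXXY i = ![2, 1, 0, 0] i := rfl
/-- Pointwise values of `eU`. -/
@[simp] theorem eU_apply (i : Fin 4) : eU i = ![0, 0, 1, 0] i := rfl

/-- Exponents differing at one index are different. -/
private theorem ne_of_apply_ne' {d e : Fin 4 →₀ ℕ} (i : Fin 4) (h : d i ≠ e i) : d ≠ e :=
  fun hde => h (by rw [hde])

/-- `eUV ≠ eYU`. -/
theorem eUV_ne_eYU : eUV ≠ eYU := ne_of_apply_ne' 1 (by simp)
/-- `eUV ≠ eYUV`. -/
theorem eUV_ne_eYUV : eUV ≠ eYUV := ne_of_apply_ne' 1 (by simp)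
/-- `eUV ≠ eXXY`. -/
theorem eUV_ne_eXXY : eUV ≠ eXXY := ne_of_apply_ne' 0 (by simp)
/-- `eYU ≠ eYUV`. -/
theorem eYU_ne_eYUV : eYU ≠ eYUV := ne_of_apply_ne' 3 (by simp)
/-- `eYU ≠ eXXY`. -/
theorem eYU_ne_eXXY : eYU ≠ eXXY := ne_of_apply_ne' 0 (by simp)
/-- `eYUV ≠ eXXY`. -/
theorem eYUV_ne_eXXY : eYUV ≠ eXXY := ne_of_apply_ne' 0 (by simp)
/-- `eUV ≠ eU`. -/
theorem eUV_ne_eU : eUV ≠ eU := ne_of_apply_ne' 3 (by simp)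
/-- `eU ≠ eYUV`. -/
theorem eU_ne_eYUV : eU ≠ eYUV := ne_of_apply_ne' 1 (by simp)
/-- `eU ≠ eXXY`. -/
theorem eU_ne_eXXY : eU ≠ eXXY := ne_of_apply_ne' 0 (by simp)

/-- `F₀ = x₃x₄ + x₂x₃ + x₂x₃x₄ + x₁²x₂` over `𝔽₂`. [folklore] -/
def F0 : MvPolynomial (Fin 4) K2 := monomial eUV 1 + monomial eYU 1 + monomial eYUV 1 + monomial eXXY 1
/-- `G₀ = x₃x₄ + x₃ + x₂x₃x₄ + x₁²x₂` = the `x₂`-chart transform of `F₀` under the point blow-up. [folklore] -/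
def G0 : MvPolynomial (Fin 4) K2 := monomial eUV 1 + monomial eU 1 + monomial eYUV 1 + monomial eXXY 1

/-- `s₀ = (F₀, r = 0, exc = {x₂})`. [folklore] -/
def s0 : State K2 := ⟨F0, 0, {1}⟩

/-- the chart point `b = (0,0,0,1)` (`x₄ ↦ x₄ + 1`). [folklore] -/
def b0 : Fin 4 → K2 := ![0, 0, 0, 1]

/-- `b 0 = 0`. -/
@[simp] theorem b0_zero : b0 0 = 0 := rfl
/-- `b 1 = 0`. -/
@[simp] theorem b0_one : b0 1 = 0 := rfl
/-- `b 2 = 0`. -/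
@[simp] theorem b0_two : b0 2 = 0 := rfl
/-- `b 3 = 1`. -/
@[simp] theorem b0_three : b0 3 = 1 := rfl

/-! ## coefficients, support, order -/

/-- Coefficients of `F₀`. -/
theorem coeff_F0 (d : Fin 4 →₀ ℕ) :
    coeff d F0 = (if eUV = d then 1 else 0) + (if eYU = d then 1 else 0) + (if eYUV = d then 1 else 0)
      + (if eXXY = d then 1 else 0) := by
  simp only [F0, coeff_add, coeff_monomial]

/-- The coefficient of `x₃x₄` in `F₀` is `1`. -/
theorem coeff_eUV_F0 : coeff eUV F0 = 1 := by
  rw [coeff_F0, if_pos rfl, if_neg eUV_ne_eYU.symm, if_neg eUV_ne_eYUV.symm, if_neg eUV_ne_eXXY.symm]; simp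
/-- The coefficient of `x₂x₃` in `F₀` is `1`. -/
theorem coeff_eYU_F0 : coeff eYU F0 = 1 := by
  rw [coeff_F0, if_neg eUV_ne_eYU, if_pos rfl, if_neg eYU_ne_eYUV.symm, if_neg eYU_ne_eXXY.symm]; simp
/-- The coefficient of `x₁²x₂` in `F₀` is `1`. -/
theorem coeff_eXXY_F0 : coeff eXXY F0 = 1 := by
  rw [coeff_F0, if_neg eUV_ne_eXXY, if_neg eYU_ne_eXXY, if_neg eYUV_ne_eXXY, if_pos rfl]; simp

/-- `F₀ ≠ 0`. -/
theorem F0_ne_zero : F0 ≠ 0 := fun h => by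
  have := coeff_eUV_F0; rw [h, coeff_zero] at this; exact zero_ne_one this

/-- The support of `F₀` is contained in its four exponents. -/
theorem support_F0_subset : F0.support ⊆ {eUV, eYU, eYUV, eXXY} := by
  intro d hd
  rw [MvPolynomial.mem_support_iff, coeff_F0] at hd
  simp only [Finset.mem_insert, Finset.mem_singleton]
  by_cases h1 : d = eUV
  · exact Or.inl h1
  by_cases h2 : d = eYU
  · exact Or.inr (Or.inl h2)
  by_cases h3 : d = eYUV
  · exact Or.inr (Or.inr (Or.inl h3))
  by_cases h4 : d = eXXY
  · exact Or.inr (Or.inr (Or.inr h4))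
  exfalso
  rw [if_neg (Ne.symm h1), if_neg (Ne.symm h2), if_neg (Ne.symm h3), if_neg (Ne.symm h4)] at hd
  simp at hd

/-- Total degree of an exponent in four variables, written out. -/
theorem degIn_univ4 (d : Fin 4 →₀ ℕ) : degIn (Finset.univ : Finset (Fin 4)) d = d 0 + d 1 + d 2 + d 3 := by
  simp [degIn, Fin.sum_univ_four]

/-- No monomial of degree `< 2` in `F₀`. [folklore] -/
theorem coeff_F0_of_degree_lt {d : Fin 4 →₀ ℕ} (hd : d.degree < 2) : coeff d F0 = 0 := by
  rw [← degIn_univ, degIn_univ4] at hd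
  have h1 : eUV ≠ d := fun h => by subst h; simp at hd
  have h2 : eYU ≠ d := fun h => by subst h; simp at hd
  have h3 : eYUV ≠ d := fun h => by subst h; simp at hd
  have h4 : eXXY ≠ d := fun h => by subst h; simp at hd
  rw [coeff_F0, if_neg h1, if_neg h2, if_neg h3, if_neg h4]; simp

/-- `ord F₀ = 2` along the point. [folklore] -/
theorem ordAlong_univ_F0 : ordAlong Finset.univ F0 = 2 := by
  apply le_antisymm
  · have := ordAlong_le_of_coeff_ne_zero (S := Finset.univ) (d := eUV) (F := F0) (by rw [coeff_eUV_F0]; exact one_ne_zero)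
    rw [degIn_univ4] at this; simpa using this
  · apply le_ordAlong_of_forall
    intro d hd
    have hd' := support_F0_subset hd
    simp only [Finset.mem_insert, Finset.mem_singleton] at hd'
    rcases hd' with rfl | rfl | rfl | rfl <;> simp [degIn_univ4]

/-! ## the point is the only Hironaka-permissible coordinate centre -/

/-- the coordinate triple `{x₂,x₃,x₄}`. [folklore] -/
def T0 : Finset (Fin 4) := {1, 2, 3}
/-- the coordinate triple `{x₁,x₃,x₄}`. [folklore] -/
def T1 : Finset (Fin 4) := {0, 2, 3}
/-- the coordinate triple `{x₁,x₂,x₄}`. [folklore] -/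
def T2 : Finset (Fin 4) := {0, 1, 3}
/-- the coordinate triple `{x₁,x₂,x₃}`. [folklore] -/
def T3 : Finset (Fin 4) := {0, 1, 2}

/-- Degree in the variables `{x₂,x₃,x₄}`. -/
theorem degIn_T0 (d : Fin 4 →₀ ℕ) : degIn T0 d = d 1 + d 2 + d 3 := degIn_triple (by decide) (by decide) (by decide) d
/-- Degree in the variables `{x₁,x₃,x₄}`. -/
theorem degIn_T1 (d : Fin 4 →₀ ℕ) : degIn T1 d = d 0 + d 2 + d 3 := degIn_triple (by decide) (by decide) (by decide) d
/-- Degree in the variables `{x₁,x₂,x₄}`. -/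
theorem degIn_T2 (d : Fin 4 →₀ ℕ) : degIn T2 d = d 0 + d 1 + d 3 := degIn_triple (by decide) (by decide) (by decide) d
/-- Degree in the variables `{x₁,x₂,x₃}`. -/
theorem degIn_T3 (d : Fin 4 →₀ ℕ) : degIn T3 d = d 0 + d 1 + d 2 := degIn_triple (by decide) (by decide) (by decide) d

/-- along every coordinate hyperplane-complement triple the order is `≤ 1`. [folklore] -/
theorem ordAlong_erase_le (i : Fin 4) : ordAlong (Finset.univ.erase i) F0 ≤ 1 := by
  fin_cases i
  · have hT : (Finset.univ : Finset (Fin 4)).erase 0 = T0 := by decide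
    have := ordAlong_le_of_coeff_ne_zero (S := T0) (d := eXXY) (F := F0) (by rw [coeff_eXXY_F0]; exact one_ne_zero)
    rw [degIn_T0] at this; simp at this; simpa [hT] using this
  · have hT : (Finset.univ : Finset (Fin 4)).erase 1 = T1 := by decide
    have := ordAlong_le_of_coeff_ne_zero (S := T1) (d := eYU) (F := F0) (by rw [coeff_eYU_F0]; exact one_ne_zero)
    rw [degIn_T1] at this; simp at this; simpa [hT] using this
  · have hT : (Finset.univ : Finset (Fin 4)).erase 2 = T2 := by decide
    have := ordAlong_le_of_coeff_ne_zero (S := T2) (d := eUV) (F := F0) (by rw [coeff_eUV_F0]; exact one_ne_zero)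
    rw [degIn_T2] at this; simp at this; simpa [hT] using this
  · have hT : (Finset.univ : Finset (Fin 4)).erase 3 = T3 := by decide
    have := ordAlong_le_of_coeff_ne_zero (S := T3) (d := eUV) (F := F0) (by rw [coeff_eUV_F0]; exact one_ne_zero)
    rw [degIn_T3] at this; simp at this; simpa [hT] using this

/-- **(2)** the point `univ` is the only Hironaka-permissible coordinate centre for `F₀`. [folklore] -/
theorem eq_univ_of_isPermissibleCentre {S : Finset (Fin 4)} (h : IsPermissibleCentre 2 S F0) :
    S = Finset.univ := by
  by_contra hS
  obtain ⟨i, hi⟩ : ∃ i, i ∉ S := by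
    by_contra hall
    push Not at hall
    exact hS (Finset.eq_univ_iff_forall.mpr hall)
  have hsub : S ⊆ Finset.univ.erase i := fun k hk =>
    Finset.mem_erase.mpr ⟨fun hki => hi (hki ▸ hk), Finset.mem_univ k⟩
  have h2 := le_trans h.2 (le_trans (ordAlong_mono hsub F0) (ordAlong_erase_le i))
  norm_num at h2

/-! ## the chart transform at `j = x₂` and the translation `x₄ ↦ x₄ + 1` -/

/-- `x₂`-chart of the point blow-up on the exponent `eUV`. -/
theorem chartExponent_eUV : chartExponent 2 Finset.univ 1 eUV = eUV := by
  rw [chartExponent_eq_iff, degIn_univ4]; refine ⟨by simp, fun i hi => ?_⟩; fin_cases i <;> simp_all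
/-- `x₂`-chart of the point blow-up on the exponent `eYU`. -/
theorem chartExponent_eYU : chartExponent 2 Finset.univ 1 eYU = eU := by
  rw [chartExponent_eq_iff, degIn_univ4]; refine ⟨by simp, fun i hi => ?_⟩; fin_cases i <;> simp_all
/-- `x₂`-chart of the point blow-up on the exponent `eYUV`. -/
theorem chartExponent_eYUV : chartExponent 2 Finset.univ 1 eYUV = eYUV := by
  rw [chartExponent_eq_iff, degIn_univ4]; refine ⟨by simp, fun i hi => ?_⟩; fin_cases i <;> simp_all
/-- `x₂`-chart of the point blow-up on the exponent `eXXY`. -/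
theorem chartExponent_eXXY : chartExponent 2 Finset.univ 1 eXXY = eXXY := by
  rw [chartExponent_eq_iff, degIn_univ4]; refine ⟨by simp, fun i hi => ?_⟩; fin_cases i <;> simp_all

/-- `x₂`-chart of the point blow-up sends `F₀` to `G₀`. [folklore] -/
theorem chartTransform_F0 : chartTransform 2 Finset.univ 1 F0 = G0 := by
  rw [F0, chartTransform_add, chartTransform_add, chartTransform_add, chartTransform_monomial,
    chartTransform_monomial, chartTransform_monomial, chartTransform_monomial,
    chartExponent_eUV, chartExponent_eYU, chartExponent_eYUV, chartExponent_eXXY, G0]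

/-- exponent identities for the monomials as products of variables. [folklore] -/
theorem single_eUV : Finsupp.single (2 : Fin 4) 1 + Finsupp.single 3 1 = eUV := by
  ext i; fin_cases i <;> simp
/-- `eYU` as a sum of singles. -/
theorem single_eYU : Finsupp.single (1 : Fin 4) 1 + Finsupp.single 2 1 = eYU := by
  ext i; fin_cases i <;> simp
/-- `eYUV` as a sum of singles. -/
theorem single_eYUV : Finsupp.single (1 : Fin 4) 1 + Finsupp.single 2 1 + Finsupp.single 3 1 = eYUV := by
  ext i; fin_cases i <;> simp
/-- `eXXY` as a sum of singles. -/
theorem single_eXXY : Finsupp.single (0 : Fin 4) 2 + Finsupp.single 1 1 = eXXY := by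
  ext i; fin_cases i <;> simp
/-- `eU` as a single. -/
theorem single_eU : Finsupp.single (2 : Fin 4) 1 = eU := by
  ext i; fin_cases i <;> simp

/-- monomials as products of variables. [folklore] -/
theorem monomial_eUV : (X 2 * X 3 : MvPolynomial (Fin 4) K2) = monomial eUV 1 := by
  rw [X, X, monomial_mul, one_mul, single_eUV]
/-- `x₂x₃` as a monomial. -/
theorem monomial_eYU : (X 1 * X 2 : MvPolynomial (Fin 4) K2) = monomial eYU 1 := by
  rw [X, X, monomial_mul, one_mul, single_eYU]
/-- `x₂x₃x₄` as a monomial. -/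
theorem monomial_eYUV : (X 1 * X 2 * X 3 : MvPolynomial (Fin 4) K2) = monomial eYUV 1 := by
  rw [X, X, X, monomial_mul, monomial_mul, one_mul, one_mul, single_eYUV]
/-- `x₁²x₂` as a monomial. -/
theorem monomial_eXXY : (X 0 ^ 2 * X 1 : MvPolynomial (Fin 4) K2) = monomial eXXY 1 := by
  rw [X_pow_eq_monomial, X, monomial_mul, one_mul, single_eXXY]
/-- `x₃` as a monomial. -/
theorem monomial_eU : (X 2 : MvPolynomial (Fin 4) K2) = monomial eU 1 := by
  rw [X, single_eU]

/-- `F₀` written with variables. -/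
theorem F0_eq_X : F0 = X 2 * X 3 + X 1 * X 2 + X 1 * X 2 * X 3 + X 0 ^ 2 * X 1 := by
  rw [F0, ← monomial_eYUV, ← monomial_eUV, ← monomial_eYU, ← monomial_eXXY]
/-- `G₀` written with variables. -/
theorem G0_eq_X : G0 = X 2 * X 3 + X 2 + X 1 * X 2 * X 3 + X 0 ^ 2 * X 1 := by
  rw [G0, ← monomial_eYUV, ← monomial_eUV, ← monomial_eXXY, ← monomial_eU]

/-- `2 = 0` in `𝔽₂[x₁..x₄]`. [folklore] -/
theorem two_eq_zero' : (2 : MvPolynomial (Fin 4) K2) = 0 := by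
  have h : (2 : K2) = 0 := by decide
  calc (2 : MvPolynomial (Fin 4) K2) = C (2 : K2) := (map_ofNat C 2).symm
    _ = 0 := by rw [h, map_zero]

/-- translating `G₀` by `x₄ ↦ x₄ + 1` gives back `F₀` (`2·x₃ = 0`). [folklore] -/
theorem translate_b0_G0 : PointBlowup.translate b0 G0 = F0 := by
  rw [G0_eq_X, F0_eq_X]
  simp only [PointBlowup.translate, map_add, map_mul, map_pow, MvPolynomial.aeval_X, b0_zero, b0_one, b0_two,
    b0_three, map_zero, map_one, add_zero]
  linear_combination (X 2 : MvPolynomial (Fin 4) K2) * two_eq_zero'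

/-- An exponent with an entry `1` is not a square exponent. -/
private theorem not_pth_of_one {d : Fin 4 →₀ ℕ} (i : Fin 4) (h : d i = 1) : ¬ IsPthPowerExponent 2 d := fun hd => by
  have := (isPthPowerExponent_iff 2 d).mp hd i; omega

/-- `F₀` is clean (no square monomials). [folklore] -/
theorem deletePthPowers_F0 : deletePthPowers 2 F0 = F0 := by
  rw [F0, deletePthPowers_add, deletePthPowers_add, deletePthPowers_add, deletePthPowers_monomial,
    deletePthPowers_monomial, deletePthPowers_monomial, deletePthPowers_monomial,
    if_neg (not_pth_of_one 3 (by simp)), if_neg (not_pth_of_one 1 (by simp)), if_neg (not_pth_of_one 1 (by simp)),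
    if_neg (not_pth_of_one 1 (by simp))]

/-! ## the step -/

/-- The transform of `s₀` at the point `b` of the `x₂`-chart of the point blow-up is `F₀` again. -/
theorem pointTransform_s0 : pointTransform 2 Finset.univ 1 b0 s0 = F0 := by
  rw [pointTransform, show s0.F = F0 from rfl, chartTransform_F0, translate_b0_G0]

/-- `b` is an equimultiple point of `s₀` in the `x₂`-chart of the point blow-up. -/
theorem isEquimultiplePoint_s0 : IsEquimultiplePoint 2 Finset.univ 1 b0 s0 := by
  intro d _ hdeg; rw [pointTransform_s0]; exact coeff_F0_of_degree_lt hdeg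

/-- Updating the zero exponent at `1` with `0` gives zero. -/
private theorem update_one_zero : (0 : Fin 4 →₀ ℕ).update 1 0 = 0 := by
  ext i; rw [Finsupp.update_apply]; split_ifs <;> rfl

/-- **(3)** the step at `b = (0,0,0,1)` of the `x₂`-chart of the point blow-up maps `s₀` to itself. [folklore] -/
theorem step_s0 : CentreBlowup.step 2 Finset.univ 1 b0 s0 = s0 := by
  have hF : deletePthPowers 2 (pointTransform 2 Finset.univ 1 b0 s0) = F0 := by rw [pointTransform_s0, deletePthPowers_F0]
  have hr : newMult 2 Finset.univ 1 b0 s0 = 0 := by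
    unfold newMult
    have hfil : (s0.r.filter fun i => b0 i = 0) = 0 := by rw [show s0.r = 0 from rfl, Finsupp.filter_zero]
    rw [hfil, show s0.F = F0 from rfl, ordAlong_univ_F0]
    exact update_one_zero
  have he : newExc 1 b0 s0 = ({1} : Finset (Fin 4)) := by
    unfold newExc; decide
  unfold CentreBlowup.step
  rw [hF, hr, he]; rfl

/-- `s₀ ⟶ s₀` is an edge of the point blow-up. [folklore] -/
theorem edge_s0 : Edge 2 Finset.univ s0 s0 :=
  ⟨1, b0, Finset.mem_univ _, rfl, isEquimultiplePoint_s0, by rw [step_s0]; exact F0_ne_zero, step_s0.symm⟩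

/-- **`{s₀}` is a trap.** [folklore] -/
theorem isTrap_singleton : IsTrap 2 ({s0} : Set (State K2)) := by
  intro s hs
  rw [Set.mem_singleton_iff] at hs
  subst hs
  refine ⟨by rw [show s0.F = F0 from rfl, ordAlong_univ_F0]; norm_num, fun S hS => ⟨s0, rfl, ?_⟩⟩
  have hSu : S = Finset.univ := eq_univ_of_isPermissibleCentre hS
  subst hSu
  exact edge_s0

end Trap1

open Trap1 in
/-- **No permissible coordinate-centre rule terminates at `p = q = 2`**: the one-state trap `{s₀}` over `𝔽₂`
(res-dim4-idea-3 TRAP-1).  A statement about the coordinate-centre frame; nothing about resolution. [folklore] -/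
theorem not_terminatesSomeRule_two : ¬ TerminatesSomeRule 2 2 :=
  not_terminatesSomeRule_of_trap 2 2 K2 {s0} isTrap_singleton ⟨s0, rfl⟩

/-- Hence `TerminatesSomeRuleQuestion` has the answer NO as stated (already at `p = 2`). [folklore] -/
theorem not_terminatesSomeRuleQuestion : ¬ TerminatesSomeRuleQuestion := fun h =>
  not_terminatesSomeRule_two (h 2 Nat.prime_two)

open Trap1 in
/-- Nor an equivariant terminating rule. [folklore] -/
theorem not_terminatesSomeEquivariantRule_two : ¬ TerminatesSomeEquivariantRule 2 2 := fun h => by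
  obtain ⟨R, hR, -, hterm⟩ := h K2
  exact not_terminatesUnder_of_trap 2 {s0} isTrap_singleton ⟨s0, rfl⟩ R hR hterm

end

end Summit.ResolutionOfSingularities.ResolutionOfSingularities.Theorems.PIDim4
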